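import Summits.QuantumFields.YangMills.Theorems.CentreWallReflectionSlabDefs
import HarnessLib

/-!
# Slab decomposition of the four-torus Wilson weight — definitions for the positivity of the one-layer kernel
# (crux `CentreWallReflection.WallReflection` ⟨stmt-QuantumFields-23707⟩, line `birth`, stub `stub_instantiate`; planner ym-idea-4 g18)

Objects for the Osterwalder–Seiler positivity of the one-layer slab kernel `Ψ_1` (link reflection positivity without gauge fixing): the
gauge action of the temporal links of a layer on the spatial links of slice `0` (`gaugeAct`), the half-weighted spatial action of slice `0`
(`spatialHalf`), and the GRAM FORM of the temporal plaquette couplings (`layerGram`: `Re tr ρ(b a⁻¹) = Σ_{ik} (Re ρ(a)_{ik} Re ρ(b)_{ik} +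
Im ρ(a)_{ik} Im ρ(b)_{ik})` for unitary `ρ`, summed over the slice-`0` links), with its features `gramFeature`.  Pure definitions.
HONEST FRAMING: bookkeeping for one crux of a draft route; nothing here proves the crux, the route's target, or the Yang–Mills mass gap.
References: [cite: OsterwalderSeiler1978, §2]; [cite: SeilerLNP1982, §3].
-/

set_option autoImplicit false

noncomputable section

open scoped BigOperators
open MeasureTheory Literature.MathematicalPhysics.QuantumFieldTheory

namespace Summit.QuantumFields.YangMills.Theorems.CentreWallReflection.Slab

variable {n : ℕ} {G : Type*} [Group G] {N : ℕ} (ρ : G →* Matrix (Fin N) (Fin N) ℂ) (μ : Fin 4)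

/-- The gauge action of the layer-`0` temporal links of `H` on the slice-`0` spatial links of `A`:
`(x, λ) ↦ H(x, μ) A(x, λ) H(x + e_λ, μ)⁻¹` (other links unchanged). -/
def gaugeAct (H A : GaugeConfig 4 (n + 1) G) : GaugeConfig 4 (n + 1) G :=
  fun e => if e.2 ≠ μ ∧ e.1 μ = 0 then H (e.1, μ) * A e * (H (e.1.shift e.2, μ))⁻¹ else A e

/-- Left multiplication of the layer-`0` temporal links of `U` by those of `H`. -/
def layerMul (H U : GaugeConfig 4 (n + 1) G) : GaugeConfig 4 (n + 1) G :=
  fun e => if e.2 = μ ∧ e.1 μ = 0 then H e * U e else U e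

/-- The half-weighted Wilson action of the spatial plaquettes of slice `0`. -/
def spatialHalf (A : GaugeConfig 4 (n + 1) G) : ℝ :=
  ∑ p : Plaquette 4 (n + 1), (if isTemporal μ p = false ∧ (p.1 μ).val = 0 then (1 / 2 : ℝ) else 0) * plaqCost ρ A p

/-- The Gram features of a configuration: real and imaginary parts of the matrix entries of `ρ` on the slice-`0` spatial links
(zero on every other link). -/
def gramFeature (f : Edge 4 (n + 1) × Fin N × Fin N × Bool) (A : GaugeConfig 4 (n + 1) G) : ℝ :=
  if f.1.2 ≠ μ ∧ f.1.1 μ = 0 then (if f.2.2.2 then (ρ (A f.1) f.2.1 f.2.2.1).re else (ρ (A f.1) f.2.1 f.2.2.1).im) else 0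

/-- The Gram form of the layer coupling: `Σ_{ℓ ∈ slice 0} Re tr(ρ(B_ℓ) ρ(A_ℓ)ᴴ)` written through the features. -/
def layerGram (A B : GaugeConfig 4 (n + 1) G) : ℝ :=
  ∑ f : Edge 4 (n + 1) × Fin N × Fin N × Bool, gramFeature ρ μ f A * gramFeature ρ μ f B

/-- The spatial direction of a temporal plaquette (the direction other than `μ`). -/
def spatialDir (p : Plaquette 4 (n + 1)) : Fin 4 := if p.2.1.1 = μ then p.2.1.2 else p.2.1.1

/-- The slice-`0` spatial link of a layer-`0` temporal plaquette. -/
def plaqEdge (p : Plaquette 4 (n + 1)) : Edge 4 (n + 1) := (p.1, spatialDir μ p)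

/-- The Gram features indexed by PLAQUETTES: real and imaginary parts of the matrix entries of `ρ` on the spatial link of each layer-`0`
temporal plaquette (zero for every other plaquette) — the form used by the positivity proof (no plaquette/link bijection needed). -/
def plaqFeature (f : Plaquette 4 (n + 1) × Fin N × Fin N × Bool) (A : GaugeConfig 4 (n + 1) G) : ℝ :=
  if isTemporal μ f.1 = true ∧ (f.1.1 μ).val = 0 then
    (if f.2.2.2 then (ρ (A (plaqEdge μ f.1)) f.2.1 f.2.2.1).re else (ρ (A (plaqEdge μ f.1)) f.2.1 f.2.2.1).im) else 0

/-- The Gram form of the layer coupling indexed by plaquettes: `Σ_{p temporal, layer 0} Re tr(ρ(B_{ℓ(p)}) ρ(A_{ℓ(p)})ᴴ)`. -/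
def plaqGram (A B : GaugeConfig 4 (n + 1) G) : ℝ :=
  ∑ f : Plaquette 4 (n + 1) × Fin N × Fin N × Bool, plaqFeature ρ μ f A * plaqFeature ρ μ f B

end Summit.QuantumFields.YangMills.Theorems.CentreWallReflection.Slab

end
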